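import Summits.QuantumAdvantage.QuantumAdvantage.Theorems.WbwObfuscatedGluedTreesKowPhPrograms
import Literature.Computability.Complexity.OracleAbsorb

/-!
# `WbwObfuscatedGluedTrees` (stmt-QuantumAdvantage-2340) — line `knowledge-of-walk-split`, STAGE 7 (the PRF hybrid):
# the bridge from the request-oracle walk game to the bit-oracle game of stage 6 (registered stub `stub_bridge`)

Helper file of the PRF hybrid (stage 7) of the line `knowledge-of-walk-split`.  Stage 6 bounds, uniformly in the
machine and its advice, the ideal-II success probability `codeSuccessProb d μ M x' k` of a walker `M` that talks to
the BIT ORACLE `bitOracle σ ν` only and is handed `name(ENTRANCE)` appended to its advice `x'`.  The walk game of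
stage 7 (`idealWalkSuccessProb d μ A k x c`) runs `A` on `⟨x, r⟩` (coins `r ∈ {0,1}^c`) against the REQUEST ORACLE
`walkOracle σ ν` (bit queries `0·q`, and the request `1·_` for `name(ENTRANCE)`).  The bridge:

* (Fubini) the count of winning pairs `(T, r)` is the sum over the coins `r` of the count of winning table
  quadruples `T`, so it suffices to bound every coin slice;
* (simulation) for a FIXED input `w = ⟨x, r⟩` a bit-oracle machine, run on `w ++ e`, replays `A` on `w` ABSORBING
  the entrance requests with the name `e` read off its own input (the tree's run-level rerelativization
  `OracleAlg.absorb` / `OracleAlg.run_absorb` of `Literature/Computability/Complexity/OracleAbsorb`, through the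
  view `[] ↦ []`, `1·_ ↦ e`, `0·q ↦ ask q`, under which the absorbed bit oracle IS the request oracle); hence a win
  of `A` on `w` is a black-box success of that machine with advice `w`, and each coin slice is a stage-6 count.

[folklore] (objects: ChildsEtAl2003 §4 Game 1; FennerFortnowKurtzLi2003IC §3.2 (rerelativization); AroraBarak2009
§3.4 (oracle machines)).
-/

set_option linter.dupNamespace false

noncomputable section

namespace Summit.QuantumAdvantage.QuantumAdvantage.Theorems.WbwObfuscatedGluedTrees.KnowledgeOfWalk.PrfHybrid

open Literature.Computability.Complexity Literature.Computability.QuantumComplexity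
open Literature.Computability.QuantumComplexity.GluedTrees
open Literature.Computability.Cryptography Literature.Computability.Cryptography.ObfuscatedGluedTrees
open Summit.QuantumAdvantage.QuantumAdvantage.Theorems.WbwObfuscatedGluedTrees.KnowledgeOfWalk.BlackBox
open Summit.QuantumAdvantage.QuantumAdvantage.Theorems.WbwObfuscatedGluedTrees.KnowledgeOfWalk.RealIdeal
open _root_.Computability

/-! ## §1 The bit-oracle simulator of a request-oracle walker -/

section Sim

variable {d N : ℕ}

/-- A run depends on the step function only through its section at the input. [folklore] -/
private theorem runAux_congr {β : Type} {M M' : OracleAlg β} {x x' : List Bool} (O : Oracle)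
    (h : ∀ as, M.step x as = M'.step x' as) (n : ℕ) :
    ∀ as : List (List Bool), M.runAux O x n as = M'.runAux O x' n as := by
  induction n with
  | zero => intro as; rfl
  | succ n ih =>
    intro as
    rw [OracleAlg.runAux_succ, OracleAlg.runAux_succ, h as]
    cases M'.step x' as with
    | inl q => exact ih _
    | inr b => rfl

/-- **The entrance view**: a view of the walker's requests (the empty request answered `[]`, an entrance request
`1·_` answered `e` — both absorbed —, a bit query `0·q` forwarded as `q`) under which, for `e = name(ENTRANCE)`,
the absorbed bit oracle of `(σ, ν)` is its request oracle. [folklore] -/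
private theorem exists_entView :
    ∃ V : List Bool → List Bool → List Bool ⊕ List Bool, ∀ (σ : CycleDatum d) (ν : NamingN d N),
      OracleAlg.absorbedOracle (V (List.ofFn (ν (entrance d)))) (bitOracle σ ν) = walkOracle σ ν :=
  ⟨fun e y => bif y.isEmpty then Sum.inl [] else bif y.headD false then Sum.inl e else Sum.inr y.tail,
    fun σ ν => by
      funext y
      rcases y with _ | ⟨_ | _, q⟩ <;> rfl⟩

/-- **The simulator**: for every walker `A`, budget `k` and game input `w` there is a bit-oracle machine which,
handed `w ++ name(ENTRANCE)`, replays `A` on `w` for `k` rounds, absorbing the entrance requests with the name read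
off its input (`inp.drop |w|`) and forwarding the bit queries (`OracleAlg.absorb`); by `OracleAlg.run_absorb` a win
of `A` against the request oracle of `(σ, ν)` on `w` is a black-box success of the machine with advice `w`.
[folklore] -/
private theorem exists_sim (A : OracleAlg (List Bool)) (k : ℕ) (w : List Bool) :
    ∃ M : OracleAlg (List Bool), ∀ (σ : CycleDatum d) (ν : NamingN d N),
      WalkWin A k w σ ν → BitSuccess M w k σ ν := by
  obtain ⟨V, hV⟩ := exists_entView (d := d) (N := N)
  refine ⟨⟨fun inp outer => (A.absorb (V (inp.drop w.length)) fun _ => k).step w outer⟩, fun σ ν h => ?_⟩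
  obtain ⟨y, hy, hpre⟩ := (walkWin_iff A k w σ ν).1 h
  refine ⟨y, ?_, hpre⟩
  -- on `w ++ e` the machine runs as the absorbed walker with the view of `e` on `w`
  have hrun : ∀ (e : List Bool) (O : Oracle) (n : ℕ),
      (⟨fun inp outer => (A.absorb (V (inp.drop w.length)) fun _ => k).step w outer⟩ :
          OracleAlg (List Bool)).run O n (w ++ e) = (A.absorb (V e) fun _ => k).run O n w :=
    fun e O n => runAux_congr O (fun as => by
      show (A.absorb (V ((w ++ e).drop w.length)) fun _ => k).step w as = _
      rw [List.drop_left]) n []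
  rw [hrun]
  exact A.run_absorb (V (List.ofFn (ν (entrance d)))) (bitOracle σ ν) w (F := fun _ => k) le_rfl (by rwa [hV])

end Sim

/-! ## §2 The registered stub -/

/-- **Stub `stub_bridge`** of crux stmt-QuantumAdvantage-2340, line `knowledge-of-walk-split`, stage 7: a uniform
bound `B` on the ideal-II bit-oracle success probability of stage 6 (all machines, all advice) bounds the ideal-II
success probability of every request-oracle walker in the walk game, for every advice `x` and coin length `c`
(average over the coins of the per-coin simulation). [folklore] -/
theorem stub_bridge :
    ∀ (d μ : ℕ) (A : OracleAlg (List Bool)) (k : ℕ) (x : List Bool) (c : ℕ) (B : ℝ),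
      (∀ (M : OracleAlg (List Bool)) (x' : List Bool), codeSuccessProb d μ M x' k ≤ B) →
      idealWalkSuccessProb d μ A k x c ≤ B := by
  intro d μ A k x c B hB
  classical
  -- the per-input simulators
  choose M hM using fun w : List Bool => exists_sim (d := d) (N := nameLen μ d) A k w
  have hT : (0 : ℝ) < Fintype.card (CodeSpace μ) := Nat.cast_pos.mpr Fintype.card_pos
  -- each coin slice is a stage-6 count
  have hslice : ∀ w : List Bool, ((Finset.univ.filter fun T : CodeSpace μ =>
      BitSuccess (M w) w k (codeCycle T d) (codeNaming T d)).card : ℝ) ≤ B * Fintype.card (CodeSpace μ) := by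
    intro w
    have h := hB (M w) w
    unfold codeSuccessProb at h
    rwa [div_le_iff₀ hT] at h
  -- the simulation, pointwise on the sample space
  have hsub : (Finset.univ.filter fun p : CodeSpace μ × List.Vector Bool c =>
        WalkWin A k (boolPair x p.2.toList) (codeCycle p.1 d) (codeNaming p.1 d)).card ≤
      (Finset.univ.filter fun p : CodeSpace μ × List.Vector Bool c =>
        BitSuccess (M (boolPair x p.2.toList)) (boolPair x p.2.toList) k (codeCycle p.1 d)
          (codeNaming p.1 d)).card := by
    refine Finset.card_le_card fun p hp => ?_
    simp only [Finset.mem_filter, Finset.mem_univ, true_and] at hp ⊢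
    exact hM _ _ _ hp
  -- Fubini over the coins
  have hfub : ((Finset.univ.filter fun p : CodeSpace μ × List.Vector Bool c =>
        BitSuccess (M (boolPair x p.2.toList)) (boolPair x p.2.toList) k (codeCycle p.1 d) (codeNaming p.1 d)).card :
          ℝ) =
      ∑ r : List.Vector Bool c, ((Finset.univ.filter fun T : CodeSpace μ =>
        BitSuccess (M (boolPair x r.toList)) (boolPair x r.toList) k (codeCycle T d) (codeNaming T d)).card : ℝ) := by
    rw [← Nat.cast_sum, Nat.cast_inj]
    simp only [Finset.card_filter]
    exact Fintype.sum_prod_type_right _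
  unfold idealWalkSuccessProb
  rw [div_le_iff₀ (Nat.cast_pos.mpr Fintype.card_pos), Fintype.card_prod, Nat.cast_mul]
  calc _ ≤ ((Finset.univ.filter fun p : CodeSpace μ × List.Vector Bool c =>
        BitSuccess (M (boolPair x p.2.toList)) (boolPair x p.2.toList) k (codeCycle p.1 d)
          (codeNaming p.1 d)).card : ℝ) := by exact_mod_cast hsub
    _ = _ := hfub
    _ ≤ ∑ _r : List.Vector Bool c, B * Fintype.card (CodeSpace μ) := Finset.sum_le_sum fun r _ => hslice _
    _ = B * ((Fintype.card (CodeSpace μ) : ℕ) * (Fintype.card (List.Vector Bool c) : ℕ) : ℝ) := by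
      rw [Finset.sum_const, Finset.card_univ, nsmul_eq_mul]
      ring

end Summit.QuantumAdvantage.QuantumAdvantage.Theorems.WbwObfuscatedGluedTrees.KnowledgeOfWalk.PrfHybrid

end
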